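import Literature.NumberTheory.GelbartRogawski1991.CMSplittingCharArchComponents
import Literature.NumberTheory.GelbartRogawski1991.DoubledUnitaryAdaptedSiegelDet
import Literature.NumberTheory.Automorphic.UnitaryGroupArchToAdelicPlaces
import HarnessLib

/-!
# The archimedean twist on the Siegel parabolic of the doubled unitary group `U(T ⊕ −T)(L ⊗ ℝ)`
([Kudla1994, §3]: `x(p) = det(p|_Δ)`; [Paul1998, §1.2]: the `det`-power characters; archimedean places of the
kernel construction of [GelbartRogawski1991, Prop. 3.1.1])

Topic `NumberTheory/GelbartRogawski1991`; namespace `Literature.NumberTheory.GelbartRogawski1991.UnitaryDualPair.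
ArchSplitting` (sequel of `CMSplittingCharArchComponents`).  KERNEL only: proved theorems; no new notion, no named fact,
no `sorry`.

Setting: `L` a CM field, `L⁺` its maximal totally real subfield, `c` complex conjugation, `T ∈ M_n(L⁺)` with `det T`
a unit, and the DOUBLED hermitian Gram matrix `J^𝔻 = e₂ (T ⊕ −T) e₂ ⊗_{L⁺} L ∈ M_{n+n}(L)` (`e₂ = finSumFinEquiv :
Fin n ⊕ Fin n ≃ Fin (n + n)`; the shape of the tree's seesaw ∕ doubling constructions).  For `g ∈ U(J^𝔻)(L ⊗ ℝ)`
write `(g, 1) = archToAdelic g ∈ U(J^𝔻)(𝔸_{L⁺})`, `M = ` its adelic matrix, and `x(g) = det((e₂⁻¹ M e₂)₁₁ +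
(e₂⁻¹ M e₂)₁₂) ∈ 𝔸_L` (Kudla's `x(p) = det(p|_Δ)` on the Siegel parabolic `P_Δ = {M₁₁ + M₁₂ = M₂₁ + M₂₂}` of the
diagonal `Δ`, [Kudla1994, §3]; the tree's `deltaBlock` ∕ `detDelta` language).

* **`IsSplittingChar.exists_archDetTwist_doubled`** — for a unitary Hecke character `χ` of `L` with
  `χ|_{𝕀_{L⁺}} = ε_{L/L⁺}` there is a CONTINUOUS character `η : U(J^𝔻)(L ⊗ ℝ) → ℂˣ` (the `det`-power twist
  `∏_v det(g_{w(v)})^{(e_{w(v)}+1)/2}` of `CMSplittingCharArchComponents`, `e` the odd ∞-type of `χ`) such that for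
  every `g` in `P_Δ(L ⊗ ℝ)` and every idele `u` of `L` with `u = x(g)`:
  `η(g)² · ∏_v det(g_{w(v)})⁻¹ = χ(u)²`.
  Ingredients: `χ(u) = χ((x(g)_∞, 1))` (the finite part of `(g,1)` is `1`, `UnitaryGroupArchToAdelicPlaces`);
  `σ_w(x(g)_w) = x(g_w)` (place components, ibid.); `det g_w = x(g_w) ∕ x(g_w)‾` (`DoubledUnitaryAdaptedSiegelDet`);
  and `CMSplittingCharArchComponents`.

This is the exact shape consumed at the archimedean places by the kernel construction of the compatible splitting
[GelbartRogawski1991, Prop. 3.1.1] (stage-1 cell `pub-hodgecm`, seat GR-3, `stub_S1arch_twist`, whose remaining factor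
`∏_v det(g_{w(v)})⁻¹` is the quotient character of Folland's normalised metaplectic section).  Nothing here is a
claim of the manuscripts adjudicated by that cell.

## References

* S. S. Kudla, Israel J. Math. 87 (1994) 361–401, §3 [Kudla1994].
* A. Paul, J. Funct. Anal. 159 (1998), §1.2 (1.2.1)–(1.2.2) p. 389 [Paul1998].
* S. Gelbart, J. Rogawski, Invent. Math. 105 (1991), §3.1 Prop. 3.1.1 p. 455 [GelbartRogawski1991].
* A. Borel, H. Jacquet, PSPM 33.1 (1979), §4.1 [BorelJacquet1979].
-/

set_option autoImplicit false

noncomputable section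

open NumberField NumberField.InfinitePlace
open scoped ComplexConjugate MatrixGroups Classical

open _root_.Literature.NumberTheory.Automorphic _root_.Literature.NumberTheory.Automorphic.UnitaryGroup
open _root_.Literature.NumberTheory.GaloisRepresentations
open _root_.Literature.RepresentationTheory.HarrisKudlaSweet1996
open _root_.Literature.NumberTheory.GelbartRogawski1991.AdaptedBlocks

namespace Literature.NumberTheory.GelbartRogawski1991.UnitaryDualPair.ArchSplitting

/-! ## § 5 Kudla's `x(p)` commutes with ring homomorphisms -/

section DeltaDet

variable {R S : Type*} [CommRing R] [CommRing S] {n : ℕ}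

/-- `f (x(M)) = x(f(M))` for `x(M) = det((e₂⁻¹ M e₂)₁₁ + (e₂⁻¹ M e₂)₁₂)` and a ring homomorphism `f`.
[cite: Kudla1994, §3] -/
theorem map_det_deltaBlock_finSum (f : R →+* S) (M : Matrix (Fin (n + n)) (Fin (n + n)) R) :
    f ((Matrix.reindex finSumFinEquiv.symm finSumFinEquiv.symm M).toBlocks₁₁ +
        (Matrix.reindex finSumFinEquiv.symm finSumFinEquiv.symm M).toBlocks₁₂).det =
      ((Matrix.reindex finSumFinEquiv.symm finSumFinEquiv.symm (M.map f)).toBlocks₁₁ +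
        (Matrix.reindex finSumFinEquiv.symm finSumFinEquiv.symm (M.map f)).toBlocks₁₂).det := by
  have h : ((Matrix.reindex finSumFinEquiv.symm finSumFinEquiv.symm M).toBlocks₁₁ +
        (Matrix.reindex finSumFinEquiv.symm finSumFinEquiv.symm M).toBlocks₁₂).map f =
      (Matrix.reindex finSumFinEquiv.symm finSumFinEquiv.symm (M.map f)).toBlocks₁₁ +
        (Matrix.reindex finSumFinEquiv.symm finSumFinEquiv.symm (M.map f)).toBlocks₁₂ := by
    rw [Matrix.map_add f (map_add f)]; rfl
  rw [RingHom.map_det, RingHom.mapMatrix_apply, h]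

/-- `x(1) = 1`. [cite: Kudla1994, §3] -/
theorem det_deltaBlock_finSum_one :
    ((Matrix.reindex finSumFinEquiv.symm finSumFinEquiv.symm (1 : Matrix (Fin (n + n)) (Fin (n + n)) R)).toBlocks₁₁ +
        (Matrix.reindex finSumFinEquiv.symm finSumFinEquiv.symm
          (1 : Matrix (Fin (n + n)) (Fin (n + n)) R)).toBlocks₁₂).det = 1 := by
  rw [Matrix.reindex_apply, Matrix.submatrix_one_equiv, ← Matrix.fromBlocks_one, Matrix.toBlocks_fromBlocks₁₁,
    Matrix.toBlocks_fromBlocks₁₂, add_zero, Matrix.det_one]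

end DeltaDet

/-! ## § 6 The twist on the Siegel parabolic of `U(T ⊕ −T)(L ⊗ ℝ)` -/

section Doubled

variable (L : Type) [Field L] [NumberField L] [IsCMField L]

/- the doubled hermitian Gram matrix `J^𝔻 = e₂ (T ⊕ −T) e₂ ⊗ L` enters as a variable `JD` pinned by the equation
`hJD` (consumers instantiate `JD` with their own name for this matrix and discharge `hJD` by `rfl`) -/
variable {n : ℕ} (T : Matrix (Fin n) (Fin n) (maximalRealSubfield L)) (hT : IsUnit T.det)
  (JD : Matrix (Fin (n + n)) (Fin (n + n)) L)
  (hJD : JD = (Matrix.reindex finSumFinEquiv finSumFinEquiv (Matrix.fromBlocks T 0 0 (-T))).map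
    (algebraMap (maximalRealSubfield L) L))
  (hc : IsCMField.complexConj L ≠ 1)
  (wOf : {v : InfinitePlace (maximalRealSubfield L) // v.IsReal} → {w : InfinitePlace L // w.IsComplex})
  (hw : ∀ v, IsCMField.complexConj L • (wOf v).1 = (wOf v).1)
  (hover : ∀ v, (wOf v).1.comap (algebraMap (maximalRealSubfield L) L) = v.1)

omit [IsCMField L] in
include hJD in
/-- `σ_w(J^𝔻) = e₂ (T_w ⊕ −T_w) e₂` with `T_w = σ_w(T)`. [cite: Kudla1994, §3] -/
theorem map_embedding_doubledGram (w : {w : InfinitePlace L // w.IsComplex}) :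
    JD.map w.1.embedding =
      Matrix.reindex finSumFinEquiv finSumFinEquiv
        (Matrix.fromBlocks (T.map ((w.1.embedding).comp (algebraMap (↥(maximalRealSubfield L)) L))) 0 0
          (-T.map ((w.1.embedding).comp (algebraMap (↥(maximalRealSubfield L)) L)))) := by
  subst hJD
  rw [Matrix.map_map, ← RingHom.coe_comp]
  simp only [Matrix.reindex_apply]
  rw [← Matrix.submatrix_map, Matrix.fromBlocks_map, Matrix.map_zero _ (map_zero _), Matrix.map_neg _ (map_neg _)]

omit [NumberField L] [IsCMField L] in
include hT in
/-- `det σ_w(T)` is a unit. [cite: Kudla1994, §3] -/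
theorem isUnit_det_map_embedding (w : {w : InfinitePlace L // w.IsComplex}) :
    IsUnit (T.map ((w.1.embedding).comp (algebraMap (↥(maximalRealSubfield L)) L))).det := by
  have h := hT.map ((w.1.embedding).comp (algebraMap (↥(maximalRealSubfield L)) L))
  rwa [RingHom.map_det, RingHom.mapMatrix_apply] at h

include hT hJD in
/-- **`det g_w = x(g_w) ∕ x(g_w)‾` on `P_Δ`**: for `g ∈ U(J^𝔻)(L ⊗ ℝ)` whose adelic matrix satisfies the Siegel
relation, the place component `g_w ∈ U(σ_w J^𝔻)(ℂ)` has determinant `x(g_w)/x(g_w)‾`, where `σ_w(x(g)_w) = x(g_w)`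
(`DoubledUnitaryAdaptedSiegelDet` at `σ = conj`, transported through `UnitaryGroupArchToAdelicPlaces`).
[cite: Kudla1994, §3] -/
theorem det_archAt_mul_conj_eq
    (g : arch (maximalRealSubfield L) L (IsCMField.complexConj L) (n + n) JD)
    (hS : (Matrix.reindex finSumFinEquiv.symm finSumFinEquiv.symm
            (((archToAdelic (maximalRealSubfield L) L (IsCMField.complexConj L) (n + n) JD g).1 :
              GL (Fin (n + n)) (AdeleRing (𝓞 L) L)) : Matrix (Fin (n + n)) (Fin (n + n)) (AdeleRing (𝓞 L) L))).toBlocks₁₁ +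
          (Matrix.reindex finSumFinEquiv.symm finSumFinEquiv.symm
            (((archToAdelic (maximalRealSubfield L) L (IsCMField.complexConj L) (n + n) JD g).1 :
              GL (Fin (n + n)) (AdeleRing (𝓞 L) L)) : Matrix (Fin (n + n)) (Fin (n + n)) (AdeleRing (𝓞 L) L))).toBlocks₁₂ =
        (Matrix.reindex finSumFinEquiv.symm finSumFinEquiv.symm
            (((archToAdelic (maximalRealSubfield L) L (IsCMField.complexConj L) (n + n) JD g).1 :
              GL (Fin (n + n)) (AdeleRing (𝓞 L) L)) : Matrix (Fin (n + n)) (Fin (n + n)) (AdeleRing (𝓞 L) L))).toBlocks₂₁ +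
          (Matrix.reindex finSumFinEquiv.symm finSumFinEquiv.symm
            (((archToAdelic (maximalRealSubfield L) L (IsCMField.complexConj L) (n + n) JD g).1 :
              GL (Fin (n + n)) (AdeleRing (𝓞 L) L)) : Matrix (Fin (n + n)) (Fin (n + n)) (AdeleRing (𝓞 L) L))).toBlocks₂₂)
    (w : {w : InfinitePlace L // w.IsComplex}) (hww : IsCMField.complexConj L • w.1 = w.1) :
    (((archAt (maximalRealSubfield L) L (IsCMField.complexConj L) (n + n) JD w hww hc g : archLocal L (n + n) JD w) :
        GL (Fin (n + n)) ℂ) : Matrix (Fin (n + n)) (Fin (n + n)) ℂ).det *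
      conj ((Matrix.reindex finSumFinEquiv.symm finSumFinEquiv.symm
              (((archAt (maximalRealSubfield L) L (IsCMField.complexConj L) (n + n) JD w hww hc g :
                archLocal L (n + n) JD w) : GL (Fin (n + n)) ℂ) : Matrix (Fin (n + n)) (Fin (n + n)) ℂ)).toBlocks₁₁ +
            (Matrix.reindex finSumFinEquiv.symm finSumFinEquiv.symm
              (((archAt (maximalRealSubfield L) L (IsCMField.complexConj L) (n + n) JD w hww hc g :
                archLocal L (n + n) JD w) : GL (Fin (n + n)) ℂ) : Matrix (Fin (n + n)) (Fin (n + n)) ℂ)).toBlocks₁₂).det =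
      ((Matrix.reindex finSumFinEquiv.symm finSumFinEquiv.symm
              (((archAt (maximalRealSubfield L) L (IsCMField.complexConj L) (n + n) JD w hww hc g :
                archLocal L (n + n) JD w) : GL (Fin (n + n)) ℂ) : Matrix (Fin (n + n)) (Fin (n + n)) ℂ)).toBlocks₁₁ +
            (Matrix.reindex finSumFinEquiv.symm finSumFinEquiv.symm
              (((archAt (maximalRealSubfield L) L (IsCMField.complexConj L) (n + n) JD w hww hc g :
                archLocal L (n + n) JD w) : GL (Fin (n + n)) ℂ) : Matrix (Fin (n + n)) (Fin (n + n)) ℂ)).toBlocks₁₂).det := by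
  -- abbreviations
  set gw : Matrix (Fin (n + n)) (Fin (n + n)) ℂ :=
    (((archAt (maximalRealSubfield L) L (IsCMField.complexConj L) (n + n) JD w hww hc g : archLocal L (n + n) JD w) :
        GL (Fin (n + n)) ℂ) : Matrix (Fin (n + n)) (Fin (n + n)) ℂ) with hgw
  set φ : AdeleRing (𝓞 L) L →+* ℂ := (Completion.extensionEmbedding w.1).comp
      ((Pi.evalRingHom (fun v : InfinitePlace L => v.Completion) w.1).comp (adeleFst L)) with hφ
  have hmap : (((archToAdelic (maximalRealSubfield L) L (IsCMField.complexConj L) (n + n) JD g).1 :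
        GL (Fin (n + n)) (AdeleRing (𝓞 L) L)) : Matrix (Fin (n + n)) (Fin (n + n)) (AdeleRing (𝓞 L) L)).map φ = gw :=
    map_placeEval_coe_archToAdelic (maximalRealSubfield L) L (IsCMField.complexConj L) (n + n) JD w hww hc g
  -- unitarity of `g_w` with respect to `σ_w(J^𝔻) = e₂ (T_w ⊕ −T_w) e₂`
  have hmem := (mem_archLocal_iff L (n + n) JD w _).1
    (archAt (maximalRealSubfield L) L (IsCMField.complexConj L) (n + n) JD w hww hc g).2
  rw [map_embedding_doubledGram L T JD hJD w] at hmem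
  -- the Siegel relation for `g_w`: map the adelic one through `φ`
  have hSw : (Matrix.reindex finSumFinEquiv.symm finSumFinEquiv.symm gw).toBlocks₁₁ +
        (Matrix.reindex finSumFinEquiv.symm finSumFinEquiv.symm gw).toBlocks₁₂ =
      (Matrix.reindex finSumFinEquiv.symm finSumFinEquiv.symm gw).toBlocks₂₁ +
        (Matrix.reindex finSumFinEquiv.symm finSumFinEquiv.symm gw).toBlocks₂₂ := by
    have h := congrArg (fun X : Matrix (Fin n) (Fin n) (AdeleRing (𝓞 L) L) => X.map φ) hS
    simp only [Matrix.map_add φ (map_add φ)] at h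
    rw [← hmap]
    exact h
  exact det_mul_map_det_deltaBlock_reindex (σ := starRingEnd ℂ) finSumFinEquiv hmem hSw
    (isUnit_det_map_embedding L T hT w) Complex.conj_conj

include hT hJD hover in
/-- **The archimedean twist on the Siegel parabolic of the doubled unitary group.**  Let `χ` be a unitary Hecke
character of the CM field `L` with `χ|_{𝕀_{L⁺}} = ε_{L/L⁺}`, `T ∈ M_n(L⁺)` with `det T` a unit, `J^𝔻 = e₂(T ⊕ −T)e₂`.
(`JD = J^𝔻`, pinned by `hJD`).  There is a continuous character `η : U(J^𝔻)(L ⊗ ℝ) → ℂˣ` such that for every `g ∈ U(J^𝔻)(L ⊗ ℝ)` whose adelic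
matrix `(g, 1)` lies in the Siegel parabolic `P_Δ` (`M₁₁ + M₁₂ = M₂₁ + M₂₂` after `e₂`) and every idele `u` of `L`
equal to Kudla's `x((g,1)) = det((g,1)|_Δ)`:  `η(g)² · ∏_v det(g_{w(v)})⁻¹ = χ(u)²`
(`η = ∏_v det(g_{w(v)})^{(e_{w(v)}+1)/2}`, `e` the odd ∞-type of `χ`: `CMSplittingCharArchComponents`).
[cite: Kudla1994, §3] [cite: Paul1998, §1.2 (1.2.1)–(1.2.2) p. 389 L11–29] -/
theorem _root_.Literature.RepresentationTheory.HarrisKudlaSweet1996.IsSplittingChar.exists_archDetTwist_doubled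
    {χ : HeckeCharacter L} (hχu : χ.IsUnitary) (hχ : IsSplittingChar L 1 χ) :
    ∃ η : arch (maximalRealSubfield L) L (IsCMField.complexConj L) (n + n) JD →* ℂˣ,
      (Continuous fun g => ((η g : ℂˣ) : ℂ)) ∧
      ∀ (g : arch (maximalRealSubfield L) L (IsCMField.complexConj L) (n + n) JD) (u : ideleGroup L),
        (Matrix.reindex finSumFinEquiv.symm finSumFinEquiv.symm
              (((archToAdelic (maximalRealSubfield L) L (IsCMField.complexConj L) (n + n) JD g).1 :
                GL (Fin (n + n)) (AdeleRing (𝓞 L) L)) : Matrix (Fin (n + n)) (Fin (n + n)) (AdeleRing (𝓞 L) L))).toBlocks₁₁ +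
            (Matrix.reindex finSumFinEquiv.symm finSumFinEquiv.symm
              (((archToAdelic (maximalRealSubfield L) L (IsCMField.complexConj L) (n + n) JD g).1 :
                GL (Fin (n + n)) (AdeleRing (𝓞 L) L)) : Matrix (Fin (n + n)) (Fin (n + n)) (AdeleRing (𝓞 L) L))).toBlocks₁₂ =
          (Matrix.reindex finSumFinEquiv.symm finSumFinEquiv.symm
              (((archToAdelic (maximalRealSubfield L) L (IsCMField.complexConj L) (n + n) JD g).1 :
                GL (Fin (n + n)) (AdeleRing (𝓞 L) L)) : Matrix (Fin (n + n)) (Fin (n + n)) (AdeleRing (𝓞 L) L))).toBlocks₂₁ +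
            (Matrix.reindex finSumFinEquiv.symm finSumFinEquiv.symm
              (((archToAdelic (maximalRealSubfield L) L (IsCMField.complexConj L) (n + n) JD g).1 :
                GL (Fin (n + n)) (AdeleRing (𝓞 L) L)) : Matrix (Fin (n + n)) (Fin (n + n)) (AdeleRing (𝓞 L) L))).toBlocks₂₂ →
        ((u : ideleGroup L) : AdeleRing (𝓞 L) L) =
          ((Matrix.reindex finSumFinEquiv.symm finSumFinEquiv.symm
              (((archToAdelic (maximalRealSubfield L) L (IsCMField.complexConj L) (n + n) JD g).1 :
                GL (Fin (n + n)) (AdeleRing (𝓞 L) L)) : Matrix (Fin (n + n)) (Fin (n + n)) (AdeleRing (𝓞 L) L))).toBlocks₁₁ +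
            (Matrix.reindex finSumFinEquiv.symm finSumFinEquiv.symm
              (((archToAdelic (maximalRealSubfield L) L (IsCMField.complexConj L) (n + n) JD g).1 :
                GL (Fin (n + n)) (AdeleRing (𝓞 L) L)) : Matrix (Fin (n + n)) (Fin (n + n)) (AdeleRing (𝓞 L) L))).toBlocks₁₂).det →
        ((η g : ℂˣ) : ℂ) ^ 2 *
            ∏ v : {v : InfinitePlace (maximalRealSubfield L) // v.IsReal},
              ((((archAt (maximalRealSubfield L) L (IsCMField.complexConj L) (n + n) JD (wOf v) (hw v) hc g :
                  archLocal L (n + n) JD (wOf v)) : GL (Fin (n + n)) ℂ) : Matrix (Fin (n + n)) (Fin (n + n)) ℂ).det)⁻¹ =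
          ((χ u : ℂˣ) : ℂ) ^ 2 := by
  obtain ⟨e, η, -, -, -, hηc, hη⟩ := hχ.exists_archDetTwist L JD hc wOf hw hover hχu
  refine ⟨η, hηc, fun g u hS hu => ?_⟩
  -- abbreviations: the adelic matrix `M` of `(g,1)` and Kudla's `x = x((g,1)) ∈ 𝔸_L`
  set M : Matrix (Fin (n + n)) (Fin (n + n)) (AdeleRing (𝓞 L) L) :=
    (((archToAdelic (maximalRealSubfield L) L (IsCMField.complexConj L) (n + n) JD g).1 :
      GL (Fin (n + n)) (AdeleRing (𝓞 L) L)) : Matrix (Fin (n + n)) (Fin (n + n)) (AdeleRing (𝓞 L) L)) with hM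
  set x : AdeleRing (𝓞 L) L := ((Matrix.reindex finSumFinEquiv.symm finSumFinEquiv.symm M).toBlocks₁₁ +
      (Matrix.reindex finSumFinEquiv.symm finSumFinEquiv.symm M).toBlocks₁₂).det with hx
  -- the finite part of `x` is `1`
  have hx2 : x.2 = 1 := by
    have h := map_det_deltaBlock_finSum (adeleSnd L) M
    rw [hM, map_snd_coe_archToAdelic, det_deltaBlock_finSum_one] at h
    exact h
  -- the infinite idele `y = x_∞` with `(y, 1) = u`
  let y : (InfiniteAdeleRing L)ˣ := Units.map (adeleFst L : AdeleRing (𝓞 L) L →* InfiniteAdeleRing L) u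
  have hyu : infiniteIdeles L y = u := by
    apply Units.ext
    change ((((u : ideleGroup L) : AdeleRing (𝓞 L) L).1, (1 : IsDedekindDomain.FiniteAdeleRing (𝓞 L) L)) :
      AdeleRing (𝓞 L) L) = _
    rw [hu]
    exact Prod.ext rfl hx2.symm
  rw [← hyu]
  refine hη g y fun v => ?_
  -- at the place `w = wOf v`: `σ_w(x_w) = x(g_w)` and `det g_w · conj x(g_w) = x(g_w)`
  have hφ : Completion.extensionEmbedding (wOf v).1 ((y : InfiniteAdeleRing L) (wOf v).1) =
      ((Matrix.reindex finSumFinEquiv.symm finSumFinEquiv.symm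
          (((archAt (maximalRealSubfield L) L (IsCMField.complexConj L) (n + n) JD (wOf v) (hw v) hc g :
            archLocal L (n + n) JD (wOf v)) : GL (Fin (n + n)) ℂ) : Matrix (Fin (n + n)) (Fin (n + n)) ℂ)).toBlocks₁₁ +
        (Matrix.reindex finSumFinEquiv.symm finSumFinEquiv.symm
          (((archAt (maximalRealSubfield L) L (IsCMField.complexConj L) (n + n) JD (wOf v) (hw v) hc g :
            archLocal L (n + n) JD (wOf v)) : GL (Fin (n + n)) ℂ) : Matrix (Fin (n + n)) (Fin (n + n)) ℂ)).toBlocks₁₂).det := by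
    have h := map_det_deltaBlock_finSum ((Completion.extensionEmbedding (wOf v).1).comp
      ((Pi.evalRingHom (fun v : InfinitePlace L => v.Completion) (wOf v).1).comp (adeleFst L))) M
    rw [hM, map_placeEval_coe_archToAdelic (maximalRealSubfield L) L (IsCMField.complexConj L) (n + n) JD (wOf v)
      (hw v) hc g] at h
    rw [← h]
    change Completion.extensionEmbedding (wOf v).1 ((((u : ideleGroup L) : AdeleRing (𝓞 L) L)).1 (wOf v).1) = _
    rw [hu]
    rfl
  have hne : Completion.extensionEmbedding (wOf v).1 ((y : InfiniteAdeleRing L) (wOf v).1) ≠ 0 := by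
    refine (map_ne_zero (Completion.extensionEmbedding (wOf v).1)).2 ?_
    exact (Units.map (Pi.evalMonoidHom (fun w : InfinitePlace L => w.Completion) (wOf v).1) y).ne_zero
  have hdet := det_archAt_mul_conj_eq L T hT JD hJD hc g hS (wOf v) (hw v)
  rw [← hφ] at hdet
  rw [eq_comm, eq_div_iff ((map_ne_zero (starRingEnd ℂ)).2 hne)]
  exact hdet

end Doubled

end Literature.NumberTheory.GelbartRogawski1991.UnitaryDualPair.ArchSplitting

end
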